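/-
Copyright (c) 2026 the pub-hodgecm-mathlib formalisation cell (harness21).  Prover seat hodgecm-mathlib-K2Liu-p03 (g7): Track B «K2-LIT», hLiu418 = stmt-HodgeConjecture-24832,
road `K2_Liu`, #41 (β) Euler face, (E8) END LEMMA (LEAD BATCH #64 (1): second hand to K2Liu-p11 (g4), over ★ FILE 10 + ★ FILE 11 + the (E8) record head BY VALUE).
-/
import Summits.HodgeConjecture.HodgeConjecture.Theorems.K2LiuArchBlockOfFrame            -- ★ FILE 10 `archBlock_prod_continuation` (K2Liu-p11)
import Summits.HodgeConjecture.HodgeConjecture.Theorems.K2LiuArchUnipotentHaarTransport   -- ★ FILE 11 `exists_integral_comp_eq_smul` (K2Liu-p11)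
import Summits.HodgeConjecture.HodgeConjecture.Theorems.K2LiuHolTubeRigidityOfFrame       -- ★ frame letters `frame_mul`, `frame_mem`, `frame_archPart_weylDelta` (+ `unipDeltaArch`)
import Summits.HodgeConjecture.HodgeConjecture.Theorems.K2LiuArchUnipotentFrameCoordinates  -- ★ (E8) record head `exists_frameCoordinates` (K2Liu-p11, p862455) — ED. 2 §5
import Mathlib.MeasureTheory.Measure.Lebesgue.EqHaar                                      -- Lebesgue on `ι → ℝ` is an additive Haar measure
import HarnessLib

/-!
# Crux `HLiu418`, road `K2_Liu`, #41 (β) Euler face, (E8) END LEMMA: the archimedean block `∫_{N_Δ(L⁺⊗ℝ)} ∏_w F_w(Fr((w_Δ)_∞·u·h) w) dν_∞(u)` is a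
# HOLOMORPHIC FUNCTION OF `s` ON `{0 < re s}` for flat families — ★ FILE 10 through ★ FILE 11, over the (E8) record head BY VALUE

Cell `hodgecm-mathlib`, crux item hLiu418 = `stmt-HodgeConjecture-24832`; squad K2 ∕ K2Liu; prover K2Liu-p03 (g7), second hand to K2Liu-p11 (g4) (LEAD F0P6-plan (g14)
BATCH #64 (1)).  THEOREMS ONLY (no `def`, no instance, no notation, no named-fact hypothesis, no `sorry`); lane `--supports stmt-HodgeConjecture-24832 --as helper`.

WHAT.  ★ FILE 10 `K2LiuArchBlockOfFrame.archBlock_prod_continuation` (K2Liu-p11): over finitely many complex places `σ`, for anti-diagonal `x_w = (0 B_w; C_w 0) ∈ U(J)`,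
`g_w ∈ U(J)`, odd weights `k_w` and compact pictures `Q_w`, there is ONE `E` holomorphic on `{0 < re s}` with `∫_{∏_w Herm₂(ℂ)} ∏_w F_w(x_w · n(b_w) · g_w) db = E(s)`
(`½ < re s`) for EVERY family `F_w ∈ I_w(s, χ_{k_w})` with `cp F_w = Q_w`.  ★ FILE 11 `K2LiuArchUnipotentHaarTransport.exists_integral_comp_eq_smul`: a left-invariant measure
finite on compacts on a group `N` homeomorphically isomorphic (`Φ`, `Φ(uv) = Φu + Φv`) to an additive locally compact second countable group integrates like `c ·` its
additive Haar measure.  THIS FILE is the END LEMMA of the (E8) record bridge (K2Liu-p11 (g3∕g4) census 16:39:31Z ∕ 16:44:30Z, desk K2Liu-p13 (g4) 16:40:35Z «presentation (a),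
∀-Haar form»), HYPOTHESIS-FIRST on the (E8) record head `K2LiuArchUnipotentFrameCoordinates.exists_frameCoordinates` (K2Liu-p11 (g4), typing): the frame coordinates
`Φ : N ≃ₜ ∏_w Herm₂` with `Φ(uv) = Φ u + Φ v` and `Fr u w = n(hermOfReal (Φ u w))` are taken BY VALUE.
* §1 **`exists_continuation_integral_prod_of_coordinates`** — generic `N`: `∃ E` holomorphic on `{0<re}`, `∀ s, ½ < re s → ∀ F (Siegel at s, cp = Q),`
  `∫_N ∏_w F_w(x_w · Fr u w · g_w) dν(u) = E(s)` for EVERY left-invariant `ν` finite on compacts (the Haar constant of ★ FILE 11 rides inside `E`).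
* §2 **`exists_continuation_integral_prod_of_frame`** — a multiplicative frame `Fr : A → ∏_w M₄(ℂ)` into `U(J)` on a group `A ≥ N` and a point `x₀` with anti-diagonal
  frames: the integrand is `∏_w F_w(Fr(x₀ · u · h) w)` (`frame_mul` twice).
* §3 **`exists_continuation_integral_unipDeltaArch`** — THE RECORD CURRENCY of ★ (E3) `exists_eulerHead_intertwiningDelta`'s arch block: `A := H_∞`, `N := N_Δ(L⁺ ⊗ ℝ)`
  (★ `unipDeltaArch`), ANY Haar measure `ν_∞` on it, the adelic frame letters `(T, Tinv, Fr, hFr, hT2, hTU)` of ★ `K2LiuHolTubeRigidityOfFrame` §2 BY VALUE, `x₀ := (w_Δ)_∞`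
  (★ `frame_archPart_weylDelta` + the anti-diagonal clause `T_w·diag(1,−1)·T_w⁻¹ = (0 B_w; C_w 0)` of ★ `exists_tubeFrame_arch₃` BY VALUE), any `h ∈ H_∞`:
  `∃ E` holomorphic on `{0 < re s}`, `∀ s, ½ < re s → ∀ F, … → ∫ ∏_w F_w(Fr((w_Δ)_∞ · u · h) w) dν_∞(u) = E(s)` — the letter `hA` of ★ `exists_bigCell_continuation_cm_of_faces`
  for every arch component presented as `a ↦ ∏_w F_{w,s}(Fr a w)` (flat: `cp F_{w,s} = Q_w`).
* §4 **(7a) INTEGRABILITY** in the same three currencies (`integrable_antidiag_transl` one place: `x = diag(−B, C)·J` and the LEFT Siegel law reduce to ★ `integrable_bigCell`;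
  `integrable_prod_of_coordinates` ∕ `_of_frame` ∕ **`integrable_prod_unipDeltaArch`**: `Φ_* ν = c • Lebesgue` + Mathlib `Integrable.fintype_prod`) — the integrability half
  `∀ s, ½ < re s → Integrable (u ↦ ∏_w F_{w,s}(Fr((w_Δ)_∞ · u · h) w)) ν_∞` of K2Liu-p13 (g4)'s (E8rec) consumer bytes (CENSUS-Beta-EndFile §2).
* §5 (ED. 2) **OF RECORD**: the coordinates `(Φ, hΦ, hΦFr)` DISCHARGED by ★ `K2LiuArchUnipotentFrameCoordinates.exists_frameCoordinates` (K2Liu-p11 (g4)) under its frame letters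
  `(T Tinv Fr hFr hT1 hT2 hTiv hTN)` + `hTU`: **`exists_continuation_integral_unipDeltaArch_of_record`**, **`integrable_prod_unipDeltaArch_of_record`** — the (E8rec)+(7a)(7b)
  consumer bytes of the (β) END file for arch components `a ↦ ∏_w F_{w,s}(Fr a w)`, no coordinate binder left.
[Shimura1997, §§5–6, §16.4]; [KudlaRallis1994, §1]; [Tan1999, §3]; [Folland1995, §2.2]; [BorelJacquet1979, §4.1].
HONEST LABEL.  Count-neutral helper: `HC_CM` is proved only modulo the 7 printed citations (2 remaining named inputs: hLiu418 = `stmt-HodgeConjecture-24832`,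
h413 = `stmt-HodgeConjecture-24833`) until rung 0 closes.  NOT here: the record head `exists_frameCoordinates` (K2Liu-p11), the presentation of the arch component of the
`T`-block as `∏_w F_w ∘ Fr` ((E6)∕(β) assembly, K2Liu-p13).
-/

set_option autoImplicit false
set_option linter.dupNamespace false -- the mandated namespace repeats `HodgeConjecture.HodgeConjecture`

noncomputable section

open Complex Matrix MeasureTheory MeasureTheory.Measure NumberField
open scoped ComplexConjugate NNReal
open Literature.NumberTheory.Automorphic Literature.NumberTheory.GelbartRogawski1991 Literature.NumberTheory.GelbartRogawski1991.GRConstruction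
open Literature.NumberTheory.K2Lit.SiegelDoubled
open Summit.HodgeConjecture.HodgeConjecture.Cruxes.HLiu418.K2LiuArchInducedTubeDefs
open Summit.HodgeConjecture.HodgeConjecture.Cruxes.HLiu418.K2LiuU22CompactPictureDefs
open Summit.HodgeConjecture.HodgeConjecture.Cruxes.HLiu418.K2LiuArchBlockOfFrame (archBlock_prod_continuation)
open Summit.HodgeConjecture.HodgeConjecture.Cruxes.HLiu418.K2LiuArchUnipotentHaarTransport (exists_integral_comp_eq_smul)
open Summit.HodgeConjecture.HodgeConjecture.Cruxes.HLiu418.K2LiuSiegelUnipotentLocalDefs (unipDeltaArch)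
open Summit.HodgeConjecture.HodgeConjecture.Cruxes.HLiu418.K2LiuHolTubeRigidityOfFrame (frame_mul frame_mem frame_archPart_weylDelta)

namespace Summit.HodgeConjecture.HodgeConjecture.Cruxes.HLiu418.K2LiuArchBlockOfFrameEnd

/-! ## §1 Generic `N`: the Haar transport of ★ FILE 10's block -/

/-- **(E8) END LEMMA, generic coordinates.**  `σ` finite; anti-diagonal `x_w = (0 B_w; C_w 0) ∈ U(J)`, `g_w ∈ U(J)`, odd `k_w`, compact pictures `Q_w` (★ FILE 10's data); a group
`N` with coordinates `Φ : N ≃ₜ ∏_w Herm₂` turning products into sums and a frame reading `Fr u w = n(hermOfReal (Φ u w))`; `ν` left-invariant and finite on compacts.  Then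
ONE `E`, holomorphic on `{0 < re s}`, computes `∫_N ∏_w F_w(x_w · Fr u w · g_w) dν(u) = E(s)` (`½ < re s`) for EVERY flat family `F_w ∈ I_w(s, χ_{k_w})`, `cp F_w = Q_w`.
[cite: Shimura1997, §16.4] [cite: KudlaRallis1994, §1] [cite: Folland1995, §2.2] -/
theorem exists_continuation_integral_prod_of_coordinates {σ : Type*} [Fintype σ] (k : σ → ℤ) (hk : ∀ w, Odd (k w)) (Q : σ → Carrier)
    (B C : σ → Matrix (Fin 2) (Fin 2) ℂ)
    (hx : ∀ w, (fromBlocks 0 (B w) (C w) 0 : Matrix (Fin 2 ⊕ Fin 2) (Fin 2 ⊕ Fin 2) ℂ)ᴴ * Matrix.J (Fin 2) ℂ *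
      (fromBlocks 0 (B w) (C w) 0 : Matrix (Fin 2 ⊕ Fin 2) (Fin 2 ⊕ Fin 2) ℂ) = Matrix.J (Fin 2) ℂ)
    (g : σ → Matrix (Fin 2 ⊕ Fin 2) (Fin 2 ⊕ Fin 2) ℂ) (hg : ∀ w, (g w)ᴴ * Matrix.J (Fin 2) ℂ * (g w) = Matrix.J (Fin 2) ℂ)
    {N : Type*} [Group N] [TopologicalSpace N] [ContinuousMul N] [MeasurableSpace N] [BorelSpace N]
    (Φ : N ≃ₜ (σ → (Fin 2 → Fin 2 → ℝ))) (hΦ : ∀ u v : N, Φ (u * v) = Φ u + Φ v)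
    (Fr : N → σ → Matrix (Fin 2 ⊕ Fin 2) (Fin 2 ⊕ Fin 2) ℂ) (hFr : ∀ u w, Fr u w = fromBlocks 1 (hermOfReal (Φ u w)) 0 1)
    (ν : Measure N) [IsFiniteMeasureOnCompacts ν] [ν.IsMulLeftInvariant] :
    ∃ E : ℂ → ℂ, DifferentiableOn ℂ E {s : ℂ | 0 < s.re} ∧ ∀ s : ℂ, 1 / 2 < s.re →
      ∀ F : σ → Matrix (Fin 2 ⊕ Fin 2) (Fin 2 ⊕ Fin 2) ℂ → ℂ, (∀ w, IsArchSiegelSection (fun z : ℂ => (conj z / ((‖z‖ : ℝ) : ℂ)) ^ (k w)) s (F w)) →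
        (∀ w, ∀ (v : Matrix (Fin 2) (Fin 2) ℂ), vᴴ * v = 1 → ∀ hv : v.det ≠ 0,
          (F w) ((2 : ℂ)⁻¹ • fromBlocks (1 + v) (-(I • (1 - v))) (I • (1 - v)) (1 + v) : Matrix (Fin 2 ⊕ Fin 2) (Fin 2 ⊕ Fin 2) ℂ) = evalAt v hv (Q w)) →
        ∫ u, ∏ w, F w ((fromBlocks 0 (B w) (C w) 0 : Matrix (Fin 2 ⊕ Fin 2) (Fin 2 ⊕ Fin 2) ℂ) * Fr u w * g w) ∂ν = E s := by
  -- Lebesgue on `∏_w Herm₂ ≅ (σ → (Fin 2 → Fin 2 → ℝ))` is an additive Haar measure (Mathlib `Measure.pi.isAddHaarMeasure`, nested `pi`; `volume_pi` is `rfl`)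
  haveI h22 : (volume : Measure (Fin 2 → Fin 2 → ℝ)).IsAddHaarMeasure := Measure.pi.isAddHaarMeasure _
  haveI : (volume : Measure (σ → (Fin 2 → Fin 2 → ℝ))).IsAddHaarMeasure := Measure.pi.isAddHaarMeasure _
  -- ★ FILE 11: `∫ G (Φ u) dν = c • ∫ G d(Lebesgue)` for EVERY `G`
  obtain ⟨c, hc⟩ := exists_integral_comp_eq_smul (volume : Measure (σ → (Fin 2 → Fin 2 → ℝ))) Φ hΦ ν (F := ℂ)
  -- ★ FILE 10: the Lebesgue block is `E₀(s)`
  obtain ⟨E₀, hE₀, hblock⟩ := archBlock_prod_continuation k hk Q B C hx g hg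
  refine ⟨fun s => ((c : ℝ) : ℂ) * E₀ s, (differentiableOn_const _).mul hE₀, fun s hs F hF hQ => ?_⟩
  have hG := hc (fun r : σ → (Fin 2 → Fin 2 → ℝ) =>
    ∏ w, F w ((fromBlocks 0 (B w) (C w) 0 : Matrix (Fin 2 ⊕ Fin 2) (Fin 2 ⊕ Fin 2) ℂ) * fromBlocks 1 (hermOfReal (r w)) 0 1 * g w))
  have hint : ∫ u, ∏ w, F w ((fromBlocks 0 (B w) (C w) 0 : Matrix (Fin 2 ⊕ Fin 2) (Fin 2 ⊕ Fin 2) ℂ) * Fr u w * g w) ∂ν =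
      ∫ u, ∏ w, F w ((fromBlocks 0 (B w) (C w) 0 : Matrix (Fin 2 ⊕ Fin 2) (Fin 2 ⊕ Fin 2) ℂ) * fromBlocks 1 (hermOfReal (Φ u w)) 0 1 * g w) ∂ν :=
    integral_congr_ae (Filter.Eventually.of_forall fun u => by simp only [hFr])
  rw [hint, hG, hblock s hs F hF hQ, NNReal.smul_def, Complex.real_smul]

/-! ## §2 A multiplicative frame on a bigger group: the integrand `∏_w F_w(Fr(x₀ · u · h) w)` -/

/-- **(E8) END LEMMA through a multiplicative frame.**  `A` a group with a frame `Fr : A → ∏_w M₄(ℂ)` into `U(J)` (`hU`) that is multiplicative (`hmul`); `N ≤ A` with coordinates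
`Φ` (`Φ(uv) = Φu + Φv`, `Fr u w = n(hermOfReal (Φ u w))` on `N`); `x₀ ∈ A` with anti-diagonal frames `Fr x₀ w = (0 B_w; C_w 0)`; `h ∈ A`.  Then ONE holomorphic `E` on `{0 < re s}`
computes `∫_N ∏_w F_w(Fr(x₀ · u · h) w) dν(u) = E(s)` (`½ < re s`) for every flat family (§1 at `g_w := Fr h w`). [cite: Shimura1997, §16.4] [cite: KudlaRallis1994, §1] -/
theorem exists_continuation_integral_prod_of_frame {σ : Type*} [Fintype σ] (k : σ → ℤ) (hk : ∀ w, Odd (k w)) (Q : σ → Carrier)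
    {A : Type*} [Group A] [TopologicalSpace A] [IsTopologicalGroup A]
    (Fr : A → σ → Matrix (Fin 2 ⊕ Fin 2) (Fin 2 ⊕ Fin 2) ℂ) (hmul : ∀ a b w, Fr (a * b) w = Fr a w * Fr b w)
    (hU : ∀ a w, (Fr a w)ᴴ * Matrix.J (Fin 2) ℂ * Fr a w = Matrix.J (Fin 2) ℂ)
    (N : Subgroup A) [MeasurableSpace N] [BorelSpace N]
    (Φ : N ≃ₜ (σ → (Fin 2 → Fin 2 → ℝ))) (hΦ : ∀ u v : N, Φ (u * v) = Φ u + Φ v)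
    (hFr : ∀ (u : N) w, Fr (u : A) w = fromBlocks 1 (hermOfReal (Φ u w)) 0 1)
    (ν : Measure N) [IsFiniteMeasureOnCompacts ν] [ν.IsMulLeftInvariant]
    (B C : σ → Matrix (Fin 2) (Fin 2) ℂ) (x₀ : A) (hx₀ : ∀ w, Fr x₀ w = fromBlocks 0 (B w) (C w) 0) (h : A) :
    ∃ E : ℂ → ℂ, DifferentiableOn ℂ E {s : ℂ | 0 < s.re} ∧ ∀ s : ℂ, 1 / 2 < s.re →
      ∀ F : σ → Matrix (Fin 2 ⊕ Fin 2) (Fin 2 ⊕ Fin 2) ℂ → ℂ, (∀ w, IsArchSiegelSection (fun z : ℂ => (conj z / ((‖z‖ : ℝ) : ℂ)) ^ (k w)) s (F w)) →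
        (∀ w, ∀ (v : Matrix (Fin 2) (Fin 2) ℂ), vᴴ * v = 1 → ∀ hv : v.det ≠ 0,
          (F w) ((2 : ℂ)⁻¹ • fromBlocks (1 + v) (-(I • (1 - v))) (I • (1 - v)) (1 + v) : Matrix (Fin 2 ⊕ Fin 2) (Fin 2 ⊕ Fin 2) ℂ) = evalAt v hv (Q w)) →
        ∫ u : N, ∏ w, F w (Fr (x₀ * (u : A) * h) w) ∂ν = E s := by
  have hx : ∀ w, (fromBlocks 0 (B w) (C w) 0 : Matrix (Fin 2 ⊕ Fin 2) (Fin 2 ⊕ Fin 2) ℂ)ᴴ * Matrix.J (Fin 2) ℂ *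
      (fromBlocks 0 (B w) (C w) 0 : Matrix (Fin 2 ⊕ Fin 2) (Fin 2 ⊕ Fin 2) ℂ) = Matrix.J (Fin 2) ℂ := fun w => by
    rw [← hx₀ w]; exact hU x₀ w
  obtain ⟨E, hE, hEq⟩ := exists_continuation_integral_prod_of_coordinates k hk Q B C hx (fun w => Fr h w) (fun w => hU h w) Φ hΦ
    (fun (u : N) w => Fr (u : A) w) hFr ν
  refine ⟨E, hE, fun s hs F hF hQ => ?_⟩
  have hint : ∫ u : N, ∏ w, F w (Fr (x₀ * (u : A) * h) w) ∂ν =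
      ∫ u : N, ∏ w, F w ((fromBlocks 0 (B w) (C w) 0 : Matrix (Fin 2 ⊕ Fin 2) (Fin 2 ⊕ Fin 2) ℂ) * Fr (u : A) w * Fr h w) ∂ν :=
    integral_congr_ae (Filter.Eventually.of_forall fun u => by simp only [hmul, hx₀])
  rw [hint]
  exact hEq s hs F hF hQ

/-! ## §3 The record currency: `N_Δ(L⁺ ⊗ ℝ) ≤ H_∞`, the adelic frame, `x₀ = (w_Δ)_∞` -/

variable (L : Type) [Field L] [NumberField L] [IsCMField L]
variable {N₀ M₀ : ℕ} (e : Fin N₀ × Fin M₀ ≃ Fin 2)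
  (dV : Fin N₀ → L) (hdV : ∀ i, IsCMField.complexConj L (dV i) = dV i)
  (dW : Fin M₀ → L) (hdW : ∀ i, IsCMField.complexConj L (dW i) = dW i)
  (T Tinv : {w : InfinitePlace L // w.IsComplex} → Matrix (Fin 2 ⊕ Fin 2) (Fin 2 ⊕ Fin 2) ℂ)
  (Fr : UnitaryGroup.arch (Fp L) L (IsCMField.complexConj L) (2 + 2) (hermD L e dV hdV dW hdW) →
    {w : InfinitePlace L // w.IsComplex} → Matrix (Fin 2 ⊕ Fin 2) (Fin 2 ⊕ Fin 2) ℂ)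
  (hFr : ∀ a w, Fr a w = T w * Matrix.reindex (e₂ (n := 2)).symm (e₂ (n := 2)).symm
    (((UnitaryGroup.archAt (Fp L) L (IsCMField.complexConj L) (2 + 2) (hermD L e dV hdV dW hdW) w
      (UnitaryGroup.complexConj_smul_infinitePlace L w.1) (IsCMField.complexConj_ne_one L) a :
        UnitaryGroup.archLocal L (2 + 2) (hermD L e dV hdV dW hdW) w) : GL (Fin (2 + 2)) ℂ) : Matrix (Fin (2 + 2)) (Fin (2 + 2)) ℂ) * Tinv w)
  (hT2 : ∀ w, Tinv w * T w = 1)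
  (hTU : ∀ w (g : GL (Fin (2 + 2)) ℂ), g ∈ UnitaryGroup.archLocal L (2 + 2) (hermD L e dV hdV dW hdW) w →
    (T w * Matrix.reindex (e₂ (n := 2)).symm (e₂ (n := 2)).symm (g : Matrix _ _ ℂ) * Tinv w)ᴴ * Matrix.J (Fin 2) ℂ *
      (T w * Matrix.reindex (e₂ (n := 2)).symm (e₂ (n := 2)).symm (g : Matrix _ _ ℂ) * Tinv w) = Matrix.J (Fin 2) ℂ)
  [MeasurableSpace ↥(unipDeltaArch L e dV hdV dW hdW)] [BorelSpace ↥(unipDeltaArch L e dV hdV dW hdW)]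
  [Fintype {w : InfinitePlace L // w.IsComplex}]

include hFr hT2 hTU in
/-- **(E8) END LEMMA IN THE RECORD CURRENCY.**  `n = 2`; the adelic frame letters `(T, Tinv, Fr, hFr, hT2, hTU)` of ★ `K2LiuHolTubeRigidityOfFrame` §2 BY VALUE; the (E8) record
head's coordinates `Φ : N_Δ(L⁺⊗ℝ) ≃ₜ ∏_w Herm₂` BY VALUE (`hΦ`, `hΦFr`); the anti-diagonal reading `T_w · diag(1,−1) · T_w⁻¹ = (0 B_w; C_w 0)` of ★ `exists_tubeFrame_arch₃` BY VALUE
(`hBC`); ANY Haar measure `ν_∞` on `N_Δ(L⁺ ⊗ ℝ)`; any `h ∈ H_∞`; odd weights `k_w`, compact pictures `Q_w`.  Then ONE `E`, holomorphic on `{0 < re s}`, computes the arch block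
of ★ (E3) `exists_eulerHead_intertwiningDelta` for EVERY flat family: `½ < re s → ∫ ∏_w F_w(Fr((w_Δ)_∞ · u · h) w) dν_∞(u) = E(s)` — the letter `hA` of ★
`exists_bigCell_continuation_cm_of_faces` for arch components `a ↦ ∏_w F_{w,s}(Fr a w)` (`frame_mul`, `frame_mem`, `frame_archPart_weylDelta`, §2).
[cite: Shimura1997, §16.4] [cite: KudlaRallis1994, §1] [cite: Tan1999, §3] [cite: BorelJacquet1979, §4.1] [cite: Folland1995, §2.2] -/
theorem exists_continuation_integral_unipDeltaArch
    (Φ : ↥(unipDeltaArch L e dV hdV dW hdW) ≃ₜ ({w : InfinitePlace L // w.IsComplex} → (Fin 2 → Fin 2 → ℝ)))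
    (hΦ : ∀ u v : ↥(unipDeltaArch L e dV hdV dW hdW), Φ (u * v) = Φ u + Φ v)
    (hΦFr : ∀ (u : ↥(unipDeltaArch L e dV hdV dW hdW)) w,
      Fr (u : UnitaryGroup.arch (Fp L) L (IsCMField.complexConj L) (2 + 2) (hermD L e dV hdV dW hdW)) w = fromBlocks 1 (hermOfReal (Φ u w)) 0 1)
    (νinf : Measure ↥(unipDeltaArch L e dV hdV dW hdW)) [νinf.IsHaarMeasure]
    (B C : {w : InfinitePlace L // w.IsComplex} → Matrix (Fin 2) (Fin 2) ℂ) (hBC : ∀ w, T w * fromBlocks 1 0 0 (-1) * Tinv w = fromBlocks 0 (B w) (C w) 0)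
    (k : {w : InfinitePlace L // w.IsComplex} → ℤ) (hk : ∀ w, Odd (k w)) (Q : {w : InfinitePlace L // w.IsComplex} → Carrier)
    (h : UnitaryGroup.arch (Fp L) L (IsCMField.complexConj L) (2 + 2) (hermD L e dV hdV dW hdW)) :
    ∃ E : ℂ → ℂ, DifferentiableOn ℂ E {s : ℂ | 0 < s.re} ∧ ∀ s : ℂ, 1 / 2 < s.re →
      ∀ F : {w : InfinitePlace L // w.IsComplex} → Matrix (Fin 2 ⊕ Fin 2) (Fin 2 ⊕ Fin 2) ℂ → ℂ,
        (∀ w, IsArchSiegelSection (fun z : ℂ => (conj z / ((‖z‖ : ℝ) : ℂ)) ^ (k w)) s (F w)) →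
        (∀ w, ∀ (v : Matrix (Fin 2) (Fin 2) ℂ), vᴴ * v = 1 → ∀ hv : v.det ≠ 0,
          (F w) ((2 : ℂ)⁻¹ • fromBlocks (1 + v) (-(I • (1 - v))) (I • (1 - v)) (1 + v) : Matrix (Fin 2 ⊕ Fin 2) (Fin 2 ⊕ Fin 2) ℂ) = evalAt v hv (Q w)) →
        ∫ u : ↥(unipDeltaArch L e dV hdV dW hdW), ∏ w, F w (Fr
            (UnitaryGroup.archPart (Fp L) L (IsCMField.complexConj L) (2 + 2) (hermD L e dV hdV dW hdW) (weylDelta L e dV hdV dW hdW) *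
              (u : UnitaryGroup.arch (Fp L) L (IsCMField.complexConj L) (2 + 2) (hermD L e dV hdV dW hdW)) * h) w) ∂νinf = E s := by
  have hx₀ : ∀ w, Fr (UnitaryGroup.archPart (Fp L) L (IsCMField.complexConj L) (2 + 2) (hermD L e dV hdV dW hdW) (weylDelta L e dV hdV dW hdW)) w =
      fromBlocks 0 (B w) (C w) 0 := fun w => by
    rw [frame_archPart_weylDelta L e dV hdV dW hdW T Tinv Fr hFr w, hBC w]
  exact exists_continuation_integral_prod_of_frame k hk Q Fr (fun a b w => frame_mul L e dV hdV dW hdW T Tinv Fr hFr hT2 a b w)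
    (fun a w => frame_mem L e dV hdV dW hdW T Tinv Fr hFr hTU a w) (unipDeltaArch L e dV hdV dW hdW) Φ hΦ hΦFr νinf B C _ hx₀ h

/-! ## §4 (7a) INTEGRABILITY on `{½ < re s}` in the same three currencies (★ `integrable_bigCell` one place + the LEFT Siegel law at the Levi `diag(−B, C)`) -/

/-- **one place**: for anti-diagonal `x = (0 B; C 0) ∈ U(J)` the translate `b ↦ F(x · n(b) · g)` is integrable on `Herm₂(ℂ)` for every `F ∈ I_w(s, χ_k)` with a compact picture and
`½ < re s` — `x = diag(−B, C) · J` with `diag(−B, C) ∈ U(J) ∩ P`, so the LEFT Siegel law makes it a constant multiple of ★ `integrable_bigCell`'s integrand `F(J · n(b) · g)`.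
[cite: Shimura1997, §16.4] [cite: KudlaRallis1994, §1] -/
theorem integrable_antidiag_transl (k : ℤ) {s : ℂ} (hs : 1 / 2 < s.re) {F : Matrix (Fin 2 ⊕ Fin 2) (Fin 2 ⊕ Fin 2) ℂ → ℂ}
    (hF : IsArchSiegelSection (fun z : ℂ => (conj z / ((‖z‖ : ℝ) : ℂ)) ^ k) s F) (Q : Carrier)
    (hFQ : ∀ (v : Matrix (Fin 2) (Fin 2) ℂ), vᴴ * v = 1 → ∀ hv : v.det ≠ 0,
      F ((2 : ℂ)⁻¹ • fromBlocks (1 + v) (-(I • (1 - v))) (I • (1 - v)) (1 + v) : Matrix (Fin 2 ⊕ Fin 2) (Fin 2 ⊕ Fin 2) ℂ) = evalAt v hv Q)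
    {B C : Matrix (Fin 2) (Fin 2) ℂ}
    (hx : (fromBlocks 0 B C 0 : Matrix (Fin 2 ⊕ Fin 2) (Fin 2 ⊕ Fin 2) ℂ)ᴴ * Matrix.J (Fin 2) ℂ * (fromBlocks 0 B C 0 : Matrix (Fin 2 ⊕ Fin 2) (Fin 2 ⊕ Fin 2) ℂ) = Matrix.J (Fin 2) ℂ)
    {g : Matrix (Fin 2 ⊕ Fin 2) (Fin 2 ⊕ Fin 2) ℂ} (hg : gᴴ * Matrix.J (Fin 2) ℂ * g = Matrix.J (Fin 2) ℂ) :
    Integrable (fun r : Fin 2 → Fin 2 → ℝ => F ((fromBlocks 0 B C 0 : Matrix (Fin 2 ⊕ Fin 2) (Fin 2 ⊕ Fin 2) ℂ) * fromBlocks 1 (hermOfReal r) 0 1 * g)) := by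
  obtain ⟨hCB, hBC⟩ := K2LiuArchBlockOfFrame.antidiag_letters hx
  have hJ : Matrix.J (Fin 2) ℂ = fromBlocks 0 (-1) 1 0 := rfl
  -- the Levi `m′ = diag(−B, C)`: `m′ · J = x`, `m′ ∈ U(J)`, `m′` block upper triangular
  have hmJ : (fromBlocks (-B) 0 0 C : Matrix (Fin 2 ⊕ Fin 2) (Fin 2 ⊕ Fin 2) ℂ) * Matrix.J (Fin 2) ℂ = fromBlocks 0 B C 0 := by
    rw [hJ, fromBlocks_multiply]; simp
  have hmU : (fromBlocks (-B) 0 0 C : Matrix (Fin 2 ⊕ Fin 2) (Fin 2 ⊕ Fin 2) ℂ)ᴴ * Matrix.J (Fin 2) ℂ * fromBlocks (-B) 0 0 C = Matrix.J (Fin 2) ℂ := by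
    have hBC' : Bᴴ * C = -1 := by rw [conjTranspose_neg, Matrix.neg_mul] at hBC; rw [← neg_neg (Bᴴ * C), hBC]
    rw [hJ, fromBlocks_conjTranspose, fromBlocks_multiply, fromBlocks_multiply]
    simp [hCB, hBC']
  have hlaw : ∀ r : Fin 2 → Fin 2 → ℝ, F ((fromBlocks 0 B C 0 : Matrix (Fin 2 ⊕ Fin 2) (Fin 2 ⊕ Fin 2) ℂ) * fromBlocks 1 (hermOfReal r) 0 1 * g) =
      (fun z : ℂ => (conj z / ((‖z‖ : ℝ) : ℂ)) ^ k) (fromBlocks (-B) 0 0 C : Matrix (Fin 2 ⊕ Fin 2) (Fin 2 ⊕ Fin 2) ℂ).toBlocks₁₁.det *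
        (((‖(fromBlocks (-B) 0 0 C : Matrix (Fin 2 ⊕ Fin 2) (Fin 2 ⊕ Fin 2) ℂ).toBlocks₁₁.det‖ : ℝ) : ℂ) ^ (2 * s + (Fintype.card (Fin 2) : ℂ))) *
        F (Matrix.J (Fin 2) ℂ * fromBlocks 1 (hermOfReal r) 0 1 * g) := fun r => by
    rw [← hmJ, Matrix.mul_assoc (fromBlocks (-B) 0 0 C) (Matrix.J (Fin 2) ℂ), Matrix.mul_assoc (fromBlocks (-B) 0 0 C)]
    exact hF _ _ hmU (by rw [toBlocks_fromBlocks₂₁])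
  simp only [hlaw]
  exact (K2LiuArchLadderPairTransport.integrable_bigCell k hs hF Q hFQ hg).const_mul _

/-- **(7a), generic coordinates**: with §1's data, `u ↦ ∏_w F_w(x_w · Fr u w · g_w)` is `ν`-integrable on `N` (`½ < re s`): the coordinates `Φ` carry `ν` to a multiple of Lebesgue
(★ FILE 11's two instances + Mathlib `isAddLeftInvariant_eq_smul`), on which the product of the one-place integrable translates is integrable (Mathlib `Integrable.fintype_prod`).
[cite: Shimura1997, §16.4] [cite: Folland1995, §2.2] -/
theorem integrable_prod_of_coordinates {σ : Type*} [Fintype σ] (k : σ → ℤ) (Q : σ → Carrier)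
    (B C : σ → Matrix (Fin 2) (Fin 2) ℂ)
    (hx : ∀ w, (fromBlocks 0 (B w) (C w) 0 : Matrix (Fin 2 ⊕ Fin 2) (Fin 2 ⊕ Fin 2) ℂ)ᴴ * Matrix.J (Fin 2) ℂ *
      (fromBlocks 0 (B w) (C w) 0 : Matrix (Fin 2 ⊕ Fin 2) (Fin 2 ⊕ Fin 2) ℂ) = Matrix.J (Fin 2) ℂ)
    (g : σ → Matrix (Fin 2 ⊕ Fin 2) (Fin 2 ⊕ Fin 2) ℂ) (hg : ∀ w, (g w)ᴴ * Matrix.J (Fin 2) ℂ * (g w) = Matrix.J (Fin 2) ℂ)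
    {N : Type*} [Group N] [TopologicalSpace N] [ContinuousMul N] [MeasurableSpace N] [BorelSpace N]
    (Φ : N ≃ₜ (σ → (Fin 2 → Fin 2 → ℝ))) (hΦ : ∀ u v : N, Φ (u * v) = Φ u + Φ v)
    (Fr : N → σ → Matrix (Fin 2 ⊕ Fin 2) (Fin 2 ⊕ Fin 2) ℂ) (hFr : ∀ u w, Fr u w = fromBlocks 1 (hermOfReal (Φ u w)) 0 1)
    (ν : Measure N) [IsFiniteMeasureOnCompacts ν] [ν.IsMulLeftInvariant]
    {s : ℂ} (hs : 1 / 2 < s.re) (F : σ → Matrix (Fin 2 ⊕ Fin 2) (Fin 2 ⊕ Fin 2) ℂ → ℂ)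
    (hF : ∀ w, IsArchSiegelSection (fun z : ℂ => (conj z / ((‖z‖ : ℝ) : ℂ)) ^ (k w)) s (F w))
    (hQ : ∀ w, ∀ (v : Matrix (Fin 2) (Fin 2) ℂ), vᴴ * v = 1 → ∀ hv : v.det ≠ 0,
      (F w) ((2 : ℂ)⁻¹ • fromBlocks (1 + v) (-(I • (1 - v))) (I • (1 - v)) (1 + v) : Matrix (Fin 2 ⊕ Fin 2) (Fin 2 ⊕ Fin 2) ℂ) = evalAt v hv (Q w)) :
    Integrable (fun u : N => ∏ w, F w ((fromBlocks 0 (B w) (C w) 0 : Matrix (Fin 2 ⊕ Fin 2) (Fin 2 ⊕ Fin 2) ℂ) * Fr u w * g w)) ν := by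
  haveI h22 : (volume : Measure (Fin 2 → Fin 2 → ℝ)).IsAddHaarMeasure := Measure.pi.isAddHaarMeasure _
  haveI : (volume : Measure (σ → (Fin 2 → Fin 2 → ℝ))).IsAddHaarMeasure := Measure.pi.isAddHaarMeasure _
  haveI := K2LiuArchUnipotentHaarTransport.isFiniteMeasureOnCompacts_map Φ ν
  haveI := K2LiuArchUnipotentHaarTransport.isAddLeftInvariant_map_of_mulHom Φ hΦ ν
  -- the product of the one-place integrable translates is Lebesgue-integrable on `∏_w Herm₂`
  have hG : Integrable (fun r : σ → (Fin 2 → Fin 2 → ℝ) =>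
      ∏ w, F w ((fromBlocks 0 (B w) (C w) 0 : Matrix (Fin 2 ⊕ Fin 2) (Fin 2 ⊕ Fin 2) ℂ) * fromBlocks 1 (hermOfReal (r w)) 0 1 * g w))
      (volume : Measure (σ → (Fin 2 → Fin 2 → ℝ))) :=
    Integrable.fintype_prod (μ := fun _ : σ => (volume : Measure (Fin 2 → Fin 2 → ℝ)))
      (f := fun w (r : Fin 2 → Fin 2 → ℝ) => F w ((fromBlocks 0 (B w) (C w) 0 : Matrix (Fin 2 ⊕ Fin 2) (Fin 2 ⊕ Fin 2) ℂ) * fromBlocks 1 (hermOfReal r) 0 1 * g w))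
      fun w => integrable_antidiag_transl (k w) hs (hF w) (Q w) (hQ w) (hx w) (hg w)
  -- `Φ_* ν = c • Lebesgue`, and `Φ` is a measurable embedding
  have hmap : Measure.map Φ ν = addHaarScalarFactor (Measure.map Φ ν) (volume : Measure (σ → (Fin 2 → Fin 2 → ℝ))) • volume :=
    isAddLeftInvariant_eq_smul _ _
  have hG' : Integrable (fun r : σ → (Fin 2 → Fin 2 → ℝ) =>
      ∏ w, F w ((fromBlocks 0 (B w) (C w) 0 : Matrix (Fin 2 ⊕ Fin 2) (Fin 2 ⊕ Fin 2) ℂ) * fromBlocks 1 (hermOfReal (r w)) 0 1 * g w)) (Measure.map Φ ν) := by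
    rw [hmap]; exact hG.smul_measure_nnreal
  have hcomp := (Φ.measurableEmbedding.integrable_map_iff).1 hG'
  refine hcomp.congr (Filter.Eventually.of_forall fun u => ?_)
  simp only [Function.comp_apply, hFr]

/-- **(7a) through a multiplicative frame** (§2's data): `u ↦ ∏_w F_w(Fr(x₀ · u · h) w)` is `ν`-integrable on `N` for `½ < re s`. [cite: Shimura1997, §16.4] [cite: KudlaRallis1994, §1] -/
theorem integrable_prod_of_frame {σ : Type*} [Fintype σ] (k : σ → ℤ) (Q : σ → Carrier)
    {A : Type*} [Group A] [TopologicalSpace A] [IsTopologicalGroup A]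
    (Fr : A → σ → Matrix (Fin 2 ⊕ Fin 2) (Fin 2 ⊕ Fin 2) ℂ) (hmul : ∀ a b w, Fr (a * b) w = Fr a w * Fr b w)
    (hU : ∀ a w, (Fr a w)ᴴ * Matrix.J (Fin 2) ℂ * Fr a w = Matrix.J (Fin 2) ℂ)
    (N : Subgroup A) [MeasurableSpace N] [BorelSpace N]
    (Φ : N ≃ₜ (σ → (Fin 2 → Fin 2 → ℝ))) (hΦ : ∀ u v : N, Φ (u * v) = Φ u + Φ v)
    (hFr : ∀ (u : N) w, Fr (u : A) w = fromBlocks 1 (hermOfReal (Φ u w)) 0 1)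
    (ν : Measure N) [IsFiniteMeasureOnCompacts ν] [ν.IsMulLeftInvariant]
    (B C : σ → Matrix (Fin 2) (Fin 2) ℂ) (x₀ : A) (hx₀ : ∀ w, Fr x₀ w = fromBlocks 0 (B w) (C w) 0) (h : A)
    {s : ℂ} (hs : 1 / 2 < s.re) (F : σ → Matrix (Fin 2 ⊕ Fin 2) (Fin 2 ⊕ Fin 2) ℂ → ℂ)
    (hF : ∀ w, IsArchSiegelSection (fun z : ℂ => (conj z / ((‖z‖ : ℝ) : ℂ)) ^ (k w)) s (F w))
    (hQ : ∀ w, ∀ (v : Matrix (Fin 2) (Fin 2) ℂ), vᴴ * v = 1 → ∀ hv : v.det ≠ 0,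
      (F w) ((2 : ℂ)⁻¹ • fromBlocks (1 + v) (-(I • (1 - v))) (I • (1 - v)) (1 + v) : Matrix (Fin 2 ⊕ Fin 2) (Fin 2 ⊕ Fin 2) ℂ) = evalAt v hv (Q w)) :
    Integrable (fun u : N => ∏ w, F w (Fr (x₀ * (u : A) * h) w)) ν := by
  have hx : ∀ w, (fromBlocks 0 (B w) (C w) 0 : Matrix (Fin 2 ⊕ Fin 2) (Fin 2 ⊕ Fin 2) ℂ)ᴴ * Matrix.J (Fin 2) ℂ *
      (fromBlocks 0 (B w) (C w) 0 : Matrix (Fin 2 ⊕ Fin 2) (Fin 2 ⊕ Fin 2) ℂ) = Matrix.J (Fin 2) ℂ := fun w => by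
    rw [← hx₀ w]; exact hU x₀ w
  have hint := integrable_prod_of_coordinates k Q B C hx (fun w => Fr h w) (fun w => hU h w) Φ hΦ (fun (u : N) w => Fr (u : A) w) hFr ν hs F hF hQ
  refine hint.congr (Filter.Eventually.of_forall fun u => ?_)
  simp only [hmul, hx₀]

include hFr hT2 hTU in
/-- **(7a) IN THE RECORD CURRENCY**: with §3's letters, `u ↦ ∏_w F_w(Fr((w_Δ)_∞ · u · h) w)` is `ν_∞`-integrable on `N_Δ(L⁺ ⊗ ℝ)` for `½ < re s` — the integrability half of the
arch face of ★ (E3)'s `T`-block for arch components `a ↦ ∏_w F_{w,s}(Fr a w)`. [cite: Shimura1997, §16.4] [cite: KudlaRallis1994, §1] [cite: BorelJacquet1979, §4.1] -/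
theorem integrable_prod_unipDeltaArch
    (Φ : ↥(unipDeltaArch L e dV hdV dW hdW) ≃ₜ ({w : InfinitePlace L // w.IsComplex} → (Fin 2 → Fin 2 → ℝ)))
    (hΦ : ∀ u v : ↥(unipDeltaArch L e dV hdV dW hdW), Φ (u * v) = Φ u + Φ v)
    (hΦFr : ∀ (u : ↥(unipDeltaArch L e dV hdV dW hdW)) w,
      Fr (u : UnitaryGroup.arch (Fp L) L (IsCMField.complexConj L) (2 + 2) (hermD L e dV hdV dW hdW)) w = fromBlocks 1 (hermOfReal (Φ u w)) 0 1)
    (νinf : Measure ↥(unipDeltaArch L e dV hdV dW hdW)) [νinf.IsHaarMeasure]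
    (B C : {w : InfinitePlace L // w.IsComplex} → Matrix (Fin 2) (Fin 2) ℂ) (hBC : ∀ w, T w * fromBlocks 1 0 0 (-1) * Tinv w = fromBlocks 0 (B w) (C w) 0)
    (k : {w : InfinitePlace L // w.IsComplex} → ℤ) (Q : {w : InfinitePlace L // w.IsComplex} → Carrier)
    (h : UnitaryGroup.arch (Fp L) L (IsCMField.complexConj L) (2 + 2) (hermD L e dV hdV dW hdW))
    {s : ℂ} (hs : 1 / 2 < s.re) (F : {w : InfinitePlace L // w.IsComplex} → Matrix (Fin 2 ⊕ Fin 2) (Fin 2 ⊕ Fin 2) ℂ → ℂ)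
    (hF : ∀ w, IsArchSiegelSection (fun z : ℂ => (conj z / ((‖z‖ : ℝ) : ℂ)) ^ (k w)) s (F w))
    (hQ : ∀ w, ∀ (v : Matrix (Fin 2) (Fin 2) ℂ), vᴴ * v = 1 → ∀ hv : v.det ≠ 0,
      (F w) ((2 : ℂ)⁻¹ • fromBlocks (1 + v) (-(I • (1 - v))) (I • (1 - v)) (1 + v) : Matrix (Fin 2 ⊕ Fin 2) (Fin 2 ⊕ Fin 2) ℂ) = evalAt v hv (Q w)) :
    Integrable (fun u : ↥(unipDeltaArch L e dV hdV dW hdW) => ∏ w, F w (Fr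
        (UnitaryGroup.archPart (Fp L) L (IsCMField.complexConj L) (2 + 2) (hermD L e dV hdV dW hdW) (weylDelta L e dV hdV dW hdW) *
          (u : UnitaryGroup.arch (Fp L) L (IsCMField.complexConj L) (2 + 2) (hermD L e dV hdV dW hdW)) * h) w)) νinf := by
  have hx₀ : ∀ w, Fr (UnitaryGroup.archPart (Fp L) L (IsCMField.complexConj L) (2 + 2) (hermD L e dV hdV dW hdW) (weylDelta L e dV hdV dW hdW)) w =
      fromBlocks 0 (B w) (C w) 0 := fun w => by
    rw [frame_archPart_weylDelta L e dV hdV dW hdW T Tinv Fr hFr w, hBC w]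
  exact integrable_prod_of_frame k Q Fr (fun a b w => frame_mul L e dV hdV dW hdW T Tinv Fr hFr hT2 a b w)
    (fun a w => frame_mem L e dV hdV dW hdW T Tinv Fr hFr hTU a w) (unipDeltaArch L e dV hdV dW hdW) Φ hΦ hΦFr νinf B C _ hx₀ h hs F hF hQ

/-! ## §5 (ED. 2) OF RECORD: the coordinates discharged by ★ `exists_frameCoordinates` -/

include hFr hT2 hTU in
/-- **(E8) END LEMMA OF RECORD — (7b) CONTINUATION, no coordinate binder.**  Under the frame letters of record `(T, Tinv, Fr, hFr, hT1, hT2, hTU, hTiv, hTN)` (★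
`K2LiuHolTubeRigidityOfFrame` §2 ∕ ★ `exists_tubeFrame_arch₃`), the anti-diagonal reading `hBC`, ANY Haar measure `ν_∞` on `N_Δ(L⁺ ⊗ ℝ)`, any `h ∈ H_∞`, odd weights and compact
pictures: ONE `E` holomorphic on `{0 < re s}` with `½ < re s → ∫ ∏_w F_w(Fr((w_Δ)_∞ · u · h) w) dν_∞(u) = E(s)` for every flat family (§3 at the coordinates of ★
`K2LiuArchUnipotentFrameCoordinates.exists_frameCoordinates`). [cite: Shimura1997, §16.4] [cite: KudlaRallis1994, §1] [cite: BorelJacquet1979, §4.1] [cite: Folland1995, §2.2] -/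
theorem exists_continuation_integral_unipDeltaArch_of_record (hT1 : ∀ w, T w * Tinv w = 1)
    (hTiv : ∀ w (u : GL (Fin (2 + 2)) ℂ), u ∈ UnitaryGroup.archLocal L (2 + 2) (hermD L e dV hdV dW hdW) w →
      K2LiuSiegelUnipotentLocalDefs.IsUnipM (n := 2) (u : Matrix (Fin (2 + 2)) (Fin (2 + 2)) ℂ) →
        ∃ b : Matrix (Fin 2) (Fin 2) ℂ, bᴴ = b ∧ T w * Matrix.reindex (e₂ (n := 2)).symm (e₂ (n := 2)).symm (u : Matrix _ _ ℂ) * Tinv w = fromBlocks 1 b 0 1)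
    (hTN : ∀ w (b : Matrix (Fin 2) (Fin 2) ℂ), bᴴ = b → ∃ u : GL (Fin (2 + 2)) ℂ,
      u ∈ UnitaryGroup.archLocal L (2 + 2) (hermD L e dV hdV dW hdW) w ∧ K2LiuSiegelUnipotentLocalDefs.IsUnipM (n := 2) (u : Matrix (Fin (2 + 2)) (Fin (2 + 2)) ℂ) ∧
        T w * Matrix.reindex (e₂ (n := 2)).symm (e₂ (n := 2)).symm (u : Matrix _ _ ℂ) * Tinv w = fromBlocks 1 b 0 1)
    (νinf : Measure ↥(unipDeltaArch L e dV hdV dW hdW)) [νinf.IsHaarMeasure]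
    (B C : {w : InfinitePlace L // w.IsComplex} → Matrix (Fin 2) (Fin 2) ℂ) (hBC : ∀ w, T w * fromBlocks 1 0 0 (-1) * Tinv w = fromBlocks 0 (B w) (C w) 0)
    (k : {w : InfinitePlace L // w.IsComplex} → ℤ) (hk : ∀ w, Odd (k w)) (Q : {w : InfinitePlace L // w.IsComplex} → Carrier)
    (h : UnitaryGroup.arch (Fp L) L (IsCMField.complexConj L) (2 + 2) (hermD L e dV hdV dW hdW)) :
    ∃ E : ℂ → ℂ, DifferentiableOn ℂ E {s : ℂ | 0 < s.re} ∧ ∀ s : ℂ, 1 / 2 < s.re →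
      ∀ F : {w : InfinitePlace L // w.IsComplex} → Matrix (Fin 2 ⊕ Fin 2) (Fin 2 ⊕ Fin 2) ℂ → ℂ,
        (∀ w, IsArchSiegelSection (fun z : ℂ => (conj z / ((‖z‖ : ℝ) : ℂ)) ^ (k w)) s (F w)) →
        (∀ w, ∀ (v : Matrix (Fin 2) (Fin 2) ℂ), vᴴ * v = 1 → ∀ hv : v.det ≠ 0,
          (F w) ((2 : ℂ)⁻¹ • fromBlocks (1 + v) (-(I • (1 - v))) (I • (1 - v)) (1 + v) : Matrix (Fin 2 ⊕ Fin 2) (Fin 2 ⊕ Fin 2) ℂ) = evalAt v hv (Q w)) →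
        ∫ u : ↥(unipDeltaArch L e dV hdV dW hdW), ∏ w, F w (Fr
            (UnitaryGroup.archPart (Fp L) L (IsCMField.complexConj L) (2 + 2) (hermD L e dV hdV dW hdW) (weylDelta L e dV hdV dW hdW) *
              (u : UnitaryGroup.arch (Fp L) L (IsCMField.complexConj L) (2 + 2) (hermD L e dV hdV dW hdW)) * h) w) ∂νinf = E s := by
  obtain ⟨Φ, hΦ, hΦFr⟩ := K2LiuArchUnipotentFrameCoordinates.exists_frameCoordinates L e dV hdV dW hdW T Tinv Fr hFr hT1 hT2 hTiv hTN
  exact exists_continuation_integral_unipDeltaArch L e dV hdV dW hdW T Tinv Fr hFr hT2 hTU Φ hΦ hΦFr νinf B C hBC k hk Q h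

include hFr hT2 hTU in
/-- **(E8) END LEMMA OF RECORD — (7a) INTEGRABILITY, no coordinate binder**: `½ < re s → Integrable (u ↦ ∏_w F_w(Fr((w_Δ)_∞ · u · h) w)) ν_∞` for every flat family (§4 at the
coordinates of ★ `exists_frameCoordinates`). [cite: Shimura1997, §16.4] [cite: KudlaRallis1994, §1] [cite: BorelJacquet1979, §4.1] -/
theorem integrable_prod_unipDeltaArch_of_record (hT1 : ∀ w, T w * Tinv w = 1)
    (hTiv : ∀ w (u : GL (Fin (2 + 2)) ℂ), u ∈ UnitaryGroup.archLocal L (2 + 2) (hermD L e dV hdV dW hdW) w →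
      K2LiuSiegelUnipotentLocalDefs.IsUnipM (n := 2) (u : Matrix (Fin (2 + 2)) (Fin (2 + 2)) ℂ) →
        ∃ b : Matrix (Fin 2) (Fin 2) ℂ, bᴴ = b ∧ T w * Matrix.reindex (e₂ (n := 2)).symm (e₂ (n := 2)).symm (u : Matrix _ _ ℂ) * Tinv w = fromBlocks 1 b 0 1)
    (hTN : ∀ w (b : Matrix (Fin 2) (Fin 2) ℂ), bᴴ = b → ∃ u : GL (Fin (2 + 2)) ℂ,
      u ∈ UnitaryGroup.archLocal L (2 + 2) (hermD L e dV hdV dW hdW) w ∧ K2LiuSiegelUnipotentLocalDefs.IsUnipM (n := 2) (u : Matrix (Fin (2 + 2)) (Fin (2 + 2)) ℂ) ∧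
        T w * Matrix.reindex (e₂ (n := 2)).symm (e₂ (n := 2)).symm (u : Matrix _ _ ℂ) * Tinv w = fromBlocks 1 b 0 1)
    (νinf : Measure ↥(unipDeltaArch L e dV hdV dW hdW)) [νinf.IsHaarMeasure]
    (B C : {w : InfinitePlace L // w.IsComplex} → Matrix (Fin 2) (Fin 2) ℂ) (hBC : ∀ w, T w * fromBlocks 1 0 0 (-1) * Tinv w = fromBlocks 0 (B w) (C w) 0)
    (k : {w : InfinitePlace L // w.IsComplex} → ℤ) (Q : {w : InfinitePlace L // w.IsComplex} → Carrier)
    (h : UnitaryGroup.arch (Fp L) L (IsCMField.complexConj L) (2 + 2) (hermD L e dV hdV dW hdW))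
    {s : ℂ} (hs : 1 / 2 < s.re) (F : {w : InfinitePlace L // w.IsComplex} → Matrix (Fin 2 ⊕ Fin 2) (Fin 2 ⊕ Fin 2) ℂ → ℂ)
    (hF : ∀ w, IsArchSiegelSection (fun z : ℂ => (conj z / ((‖z‖ : ℝ) : ℂ)) ^ (k w)) s (F w))
    (hQ : ∀ w, ∀ (v : Matrix (Fin 2) (Fin 2) ℂ), vᴴ * v = 1 → ∀ hv : v.det ≠ 0,
      (F w) ((2 : ℂ)⁻¹ • fromBlocks (1 + v) (-(I • (1 - v))) (I • (1 - v)) (1 + v) : Matrix (Fin 2 ⊕ Fin 2) (Fin 2 ⊕ Fin 2) ℂ) = evalAt v hv (Q w)) :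
    Integrable (fun u : ↥(unipDeltaArch L e dV hdV dW hdW) => ∏ w, F w (Fr
        (UnitaryGroup.archPart (Fp L) L (IsCMField.complexConj L) (2 + 2) (hermD L e dV hdV dW hdW) (weylDelta L e dV hdV dW hdW) *
          (u : UnitaryGroup.arch (Fp L) L (IsCMField.complexConj L) (2 + 2) (hermD L e dV hdV dW hdW)) * h) w)) νinf := by
  obtain ⟨Φ, hΦ, hΦFr⟩ := K2LiuArchUnipotentFrameCoordinates.exists_frameCoordinates L e dV hdV dW hdW T Tinv Fr hFr hT1 hT2 hTiv hTN
  exact integrable_prod_unipDeltaArch L e dV hdV dW hdW T Tinv Fr hFr hT2 hTU Φ hΦ hΦFr νinf B C hBC k Q h hs F hF hQ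

end Summit.HodgeConjecture.HodgeConjecture.Cruxes.HLiu418.K2LiuArchBlockOfFrameEnd

end
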